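import Summits.QuantumAdvantage.QuantumAdvantage.Theorems.CubicForrelationNearExactIsExactKtGapAll

/-!
# Crux `CubicForrelation.NearExactIsExact` (stmt-QuantumAdvantage-14043) — tools for the SECOND Kasami–Tokura gap of cubics
  (no weight of `RM(3,m)` strictly between `1.75·d` and `1.875·d`, `d = 2^{m-3}`), I: four-valued derivative intersections,
  three-valued bookkeeping, `⊕`-closed sets have `2^j` elements, character sums of a minimum-weight word

Certificate seat `b2b-cforr-cert` (gen 18).  HONEST FRAMING: elementary coding-theory TOOLS (standard axioms, uniform in the number of bits)
for the brick "no cubic Boolean function on `m ≤ 12` bits has weight strictly between `7·2^{m-5}` and `7.5·2^{m-5}`"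
(`…KtGapTwoCubic.lean`) — at `m = 12` the values `904, …, 952`, i.e. the whole TYPE-O branch of the `n = 12` window analysis on
`(932/1024, 936/1024]` (`to18_typeO_gt932_weight`: a type-O side with `Φ > 932/1024` has a cubic base set `E` with `896 < #E < 960`).
NOT summit progress.

* `ktg2_deriv_values`: for a cubic support `E` with `64·#E < 15·2^m` and any `a`, `I(a) = #(E ∩ (E ⊕ a))` satisfies
  `32 I + 7·2^m = 32 #E ∨ 16 I + 3·2^m = 16 #E ∨ 8 I + 2^m = 8 #E ∨ I = #E` (the quadratic `c ⊕ c(·⊕a)` has Walsh value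
  `2^m − 4#E + 4I > 2^m/16` at `0`, and quadratic spectra are plateaued, `stub_quadWalshPlateau`).
* `ktg2_sum_three_values`: sums of a function taking three values off one point.
* `ktg2_xor_closed_card`: a `⊕`-closed set of vectors containing `0` has `2^j` elements (coordinate filtration; no linear algebra).
* `ktg2_minweight_twist_sum`: the character sums `Σ_{x∈U} (−1)^{x·z}` of a minimum-weight word `U` of `RM(d+1,m)` (a flat, by
  `mw_flat_of_minweight`) lie in `{0, ±#U}`.

References: T. Kasami, N. Tokura, *On the weight structure of Reed–Muller codes*, IEEE Trans. IT 16 (1970) 752–759; F. J. MacWilliams,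
N. J. A. Sloane (1977) Ch. 13 §4, Ch. 15 §3; R. O'Donnell (2014) §3.3.  Everything below is proved from Mathlib and the tree; axioms are
the standard three.
-/

set_option linter.dupNamespace false -- D-0017: single-problem summit ⇒ `QuantumAdvantage.QuantumAdvantage` by design

noncomputable section

namespace Summit.QuantumAdvantage.QuantumAdvantage.Theorems.CubicForrelation.NearExactIsExact

open Finset
open Literature.Computability.QuantumComplexity
open Literature.Computability.QuantumComplexity.BuzetChailloux (bxor zeroVec bxor_bxor_cancel_left bxor_zeroVec zeroVec_bxor bxor_comm
  bxor_self twist_zeroVec_right twist_bxor_right)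
open Literature.Computability.QuantumComplexity.DerivativeWalsh (W twist_bxor_left sum_twist_subspace)
open Literature.Computability.QuantumComplexity.Simon (twist_eq_one_or)

/-! ### Four-valued derivative intersections below `1.875 d` -/

/-- **Derivative intersections below `1.875·d`.**  For a cubic `c` on `m` bits with support `E`, `64·#E < 15·2^m`, and any `a`:
`I(a) = #(E ∩ (E ⊕ a))` satisfies `32 I + 7·2^m = 32 #E`, or `16 I + 3·2^m = 16 #E`, or `8 I + 2^m = 8 #E`, or `I = #E`
(the derivative `c ⊕ c(·⊕a)` is a plateaued quadratic whose Walsh value at `0`, `2^m − 4#E + 4I`, exceeds `2^m/16`).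
[this work; cite: KasamiTokura1970, MacWilliamsSloane1977 Ch. 15 §2] -/
theorem ktg2_deriv_values {m : ℕ} (c : (Fin m → Bool) → Bool) (hc : IsDegLeFun 3 c)
    (h2 : 64 * #(univ.filter fun x => c x = true) < 15 * 2 ^ m) (a : Fin m → Bool) :
    32 * #((univ.filter fun x => c x = true).filter fun x => bxor x a ∈ univ.filter fun x => c x = true) + 7 * 2 ^ m =
        32 * #(univ.filter fun x => c x = true) ∨
      16 * #((univ.filter fun x => c x = true).filter fun x => bxor x a ∈ univ.filter fun x => c x = true) + 3 * 2 ^ m =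
        16 * #(univ.filter fun x => c x = true) ∨
      8 * #((univ.filter fun x => c x = true).filter fun x => bxor x a ∈ univ.filter fun x => c x = true) + 2 ^ m =
        8 * #(univ.filter fun x => c x = true) ∨
      #((univ.filter fun x => c x = true).filter fun x => bxor x a ∈ univ.filter fun x => c x = true) =
        #(univ.filter fun x => c x = true) := by
  classical
  set S := univ.filter (fun x : Fin m → Bool => c x = true) with hSdef
  have hmemS : ∀ x, x ∈ S ↔ c x = true := fun x => by simp [hSdef]
  set I := #(S.filter fun x => bxor x a ∈ S) with hIdef
  have hIle : I ≤ #S := card_filter_le _ _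
  -- trivial case `S = ∅`
  by_cases hS0 : #S = 0
  · right; right; right; omega
  -- `m ≥ 3`
  have hSle : #S ≤ 2 ^ m := by
    calc #S ≤ #(univ : Finset (Fin m → Bool)) := card_le_univ _
      _ = 2 ^ m := by rw [card_univ, Fintype.card_fun, Fintype.card_bool, Fintype.card_fin]
  obtain ⟨j, rfl⟩ : ∃ j, m = j + 3 := by
    rcases Nat.lt_or_ge m 3 with hm | hm
    · exfalso
      have : 2 ^ m ≤ 2 ^ 2 := Nat.pow_le_pow_right (by norm_num) (by omega)
      omega
    · exact ⟨m - 3, by omega⟩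
  have hN : (2 : ℝ) ^ (j + 3) = 8 * 2 ^ j := by ring
  have hind : ∀ x, signOf (c x) = 1 - 2 * (if x ∈ S then (1 : ℝ) else 0) := by
    intro x
    by_cases hx : x ∈ S
    · rw [if_pos hx]; have hc' := (hmemS x).1 hx; unfold signOf; rw [if_pos hc']; norm_num
    · rw [if_neg hx]
      have hc' : ¬ c x = true := fun h => hx ((hmemS x).2 h)
      unfold signOf; rw [if_neg hc']; norm_num
  have hD : IsDegLeFun 2 (fun x => c x ^^ c (bxor x a)) := stub_derivDegree (j + 3) 2 c a hc
  obtain ⟨s, hs⟩ := stub_quadWalshPlateau (j + 3) _ hD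
  have hW0 : W (fun x => signOf (c x ^^ c (bxor x a))) zeroVec = 2 ^ (j + 3) - 4 * (#S : ℝ) + 4 * (I : ℝ) := by
    unfold W
    simp_rw [twist_zeroVec_right, mul_one, signOf_xor]
    rw [sum_congr rfl fun x _ => by rw [hind x, hind (bxor x a)]]
    have e1 : ∀ x : Fin (j + 3) → Bool, (1 - 2 * (if x ∈ S then (1 : ℝ) else 0)) * (1 - 2 * (if bxor x a ∈ S then (1 : ℝ) else 0)) =
        1 - 2 * (if x ∈ S then (1 : ℝ) else 0) - 2 * (if bxor x a ∈ S then (1 : ℝ) else 0) +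
          4 * (if (x ∈ S ∧ bxor x a ∈ S) then (1 : ℝ) else 0) := by
      intro x; by_cases h1 : x ∈ S <;> by_cases h2 : bxor x a ∈ S <;> norm_num [h1, h2]
    rw [sum_congr rfl fun x _ => e1 x, sum_add_distrib, sum_sub_distrib, sum_sub_distrib, sum_const, card_univ, Fintype.card_fun,
      Fintype.card_bool, Fintype.card_fin, ← mul_sum, ← mul_sum, ← mul_sum, sum_boole, sum_boole, sum_boole]
    have c1 : #(univ.filter fun x : Fin (j + 3) → Bool => x ∈ S) = #S := by
      rw [show (univ.filter fun x : Fin (j + 3) → Bool => x ∈ S) = S by ext x; simp]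
    have c2 : #(univ.filter fun x : Fin (j + 3) → Bool => bxor x a ∈ S) = #S := by
      refine card_nbij' (fun x => bxor x a) (fun x => bxor x a) (fun x hx => ?_) (fun x hx => ?_)
        (fun x _ => by show bxor (bxor x a) a = x; rw [iw_bxor_assoc, bxor_self, bxor_zeroVec])
        (fun x _ => by show bxor (bxor x a) a = x; rw [iw_bxor_assoc, bxor_self, bxor_zeroVec])
      · rw [mem_coe, mem_filter] at hx; exact hx.2
      · rw [mem_coe] at hx; rw [mem_coe, mem_filter, iw_bxor_assoc, bxor_self, bxor_zeroVec]; exact ⟨mem_univ _, hx⟩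
    have c3 : #(univ.filter fun x : Fin (j + 3) → Bool => x ∈ S ∧ bxor x a ∈ S) = I := by
      simp only [I]; congr 1; ext x; simp
    rw [c1, c2, c3]
    norm_num; ring
  have hS2 : 64 * (#S : ℝ) < 15 * 2 ^ (j + 3) := by exact_mod_cast h2
  have hIle' : (I : ℝ) ≤ #S := by exact_mod_cast hIle
  have hI0 : (0 : ℝ) ≤ I := by positivity
  have hPj : (0 : ℝ) < 2 ^ j := by positivity
  rcases hs zeroVec with h0 | hsq
  · exfalso
    rw [hW0, hN] at h0
    linarith
  · rw [hW0] at hsq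
    have h4 : (4 : ℝ) ^ s = ((2 : ℝ) ^ s) ^ 2 := by
      rw [show (4 : ℝ) = 2 ^ 2 by norm_num, ← pow_mul, mul_comm, pow_mul]
    rw [h4] at hsq
    have hpos : (0 : ℝ) ≤ 2 ^ (j + 3) - 4 * (#S : ℝ) + 4 * (I : ℝ) := by rw [hN]; linarith
    have h2s : 2 ^ (j + 3) - 4 * (#S : ℝ) + 4 * (I : ℝ) = (2 : ℝ) ^ s :=
      (pow_left_inj₀ hpos (by positivity) (by norm_num : (2 : ℕ) ≠ 0)).1 hsq
    have hs_le : s ≤ j + 3 := by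
      by_contra h
      push Not at h
      have : (2 : ℝ) ^ (j + 4) ≤ 2 ^ s := pow_le_pow_right₀ (by norm_num) h
      rw [pow_succ] at this
      linarith
    have hs_ge : j ≤ s := by
      by_contra h
      push Not at h
      have h29 : (2 : ℝ) ^ (s + 1) ≤ 2 ^ j := pow_le_pow_right₀ (by norm_num) (by omega)
      rw [pow_succ] at h29
      rw [hN] at h2s
      linarith
    obtain ⟨i, hi, rfl⟩ : ∃ i, i ≤ 3 ∧ s = j + i := ⟨s - j, by omega, by omega⟩
    have e : (2 : ℝ) ^ (j + i) = 2 ^ j * 2 ^ i := by ring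
    rw [e, hN] at h2s
    interval_cases i
    · left
      have h' : (32 * I + 7 * 2 ^ (j + 3) : ℝ) = 32 * #S := by rw [hN]; linarith
      exact_mod_cast h'
    · right; left
      have h' : (16 * I + 3 * 2 ^ (j + 3) : ℝ) = 16 * #S := by rw [hN]; linarith
      exact_mod_cast h'
    · right; right; left
      have h' : (8 * I + 2 ^ (j + 3) : ℝ) = 8 * #S := by rw [hN]; linarith
      exact_mod_cast h'
    · right; right; right
      have h' : (I : ℝ) = #S := by linarith
      exact_mod_cast h'

/-! ### Bookkeeping: sums of a function taking three values off one point -/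

/-- If `g` takes only the pairwise distinct values `α, β, γ` off the point `z₀`, then
`Σ_z φ(g z) = φ(g z₀) + A·φ(α) + B·φ(β) + C·φ(γ)` with `A = #{z ≠ z₀ : g z = α}`, `B = #{z ≠ z₀ : g z = β}`, `C = #{z ≠ z₀ : g z = γ}`,
and `A + B + C + 1 = #ι`. [folklore] -/
theorem ktg2_sum_three_values {ι : Type*} [Fintype ι] [DecidableEq ι] (g : ι → ℝ) (z₀ : ι) (α β γ : ℝ) (hαβ : α ≠ β)
    (hαγ : α ≠ γ) (hβγ : β ≠ γ) (h : ∀ z, z ≠ z₀ → g z = α ∨ g z = β ∨ g z = γ) (φ : ℝ → ℝ) :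
    ∑ z, φ (g z) = φ (g z₀) + #(univ.filter fun z => z ≠ z₀ ∧ g z = α) * φ α + #(univ.filter fun z => z ≠ z₀ ∧ g z = β) * φ β +
        #(univ.filter fun z => z ≠ z₀ ∧ g z = γ) * φ γ ∧
      #(univ.filter fun z => z ≠ z₀ ∧ g z = α) + #(univ.filter fun z => z ≠ z₀ ∧ g z = β) +
        #(univ.filter fun z => z ≠ z₀ ∧ g z = γ) + 1 = Fintype.card ι := by
  classical
  set TA := univ.filter (fun z => z ≠ z₀ ∧ g z = α) with hTA
  set TB := univ.filter (fun z => z ≠ z₀ ∧ g z = β) with hTB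
  set TC := univ.filter (fun z => z ≠ z₀ ∧ g z = γ) with hTC
  have hdAB : Disjoint TA TB := by
    rw [hTA, hTB, disjoint_filter]; intro z _ h1 h2; exact hαβ (h1.2.symm.trans h2.2)
  have hdABC : Disjoint (TA ∪ TB) TC := by
    rw [hTA, hTB, hTC, disjoint_left]
    intro z hz hzC
    rw [mem_union, mem_filter, mem_filter] at hz
    rw [mem_filter] at hzC
    rcases hz with h1 | h1
    · exact hαγ (h1.2.2.symm.trans hzC.2.2)
    · exact hβγ (h1.2.2.symm.trans hzC.2.2)
  have hdisj0 : Disjoint ((TA ∪ TB) ∪ TC) {z₀} := disjoint_singleton_right.2 (by simp [hTA, hTB, hTC])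
  have hcover : (univ : Finset ι) = ((TA ∪ TB) ∪ TC) ∪ {z₀} := by
    ext z
    simp only [mem_univ, mem_union, mem_singleton, hTA, hTB, hTC, mem_filter, true_and, true_iff]
    by_cases hz : z = z₀
    · exact Or.inr hz
    · rcases h z hz with hg | hg | hg
      · exact Or.inl (Or.inl (Or.inl ⟨hz, hg⟩))
      · exact Or.inl (Or.inl (Or.inr ⟨hz, hg⟩))
      · exact Or.inl (Or.inr ⟨hz, hg⟩)
  have hA : ∑ z ∈ TA, φ (g z) = #TA * φ α := by
    rw [sum_congr rfl (g := fun _ => φ α) fun z hz => by rw [(mem_filter.1 hz).2.2], sum_const, nsmul_eq_mul]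
  have hB : ∑ z ∈ TB, φ (g z) = #TB * φ β := by
    rw [sum_congr rfl (g := fun _ => φ β) fun z hz => by rw [(mem_filter.1 hz).2.2], sum_const, nsmul_eq_mul]
  have hC : ∑ z ∈ TC, φ (g z) = #TC * φ γ := by
    rw [sum_congr rfl (g := fun _ => φ γ) fun z hz => by rw [(mem_filter.1 hz).2.2], sum_const, nsmul_eq_mul]
  constructor
  · rw [hcover, sum_union hdisj0, sum_union hdABC, sum_union hdAB, sum_singleton, hA, hB, hC]
    ring
  · have h := congrArg card hcover
    rw [card_union_of_disjoint hdisj0, card_union_of_disjoint hdABC, card_union_of_disjoint hdAB, card_singleton, card_univ] at h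
    omega

/-! ### A `⊕`-closed set of vectors containing `0` has `2^j` elements -/

/-- **A `⊕`-closed set of Boolean vectors containing `0` has cardinality a power of two** (filter by the vanishing of the first `i`
coordinates: each step keeps the set or halves it, by the translation `y ↦ y ⊕ x₀`). [folklore; Lagrange for `(𝔽₂^m, ⊕)`] -/
theorem ktg2_xor_closed_card {m : ℕ} (T : Finset (Fin m → Bool)) (hT0 : zeroVec ∈ T)
    (hadd : ∀ a ∈ T, ∀ b ∈ T, bxor a b ∈ T) : ∃ j, #T = 2 ^ j := by
  classical
  -- `P i` = the elements of `T` vanishing on the coordinates `< i`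
  set P : ℕ → Finset (Fin m → Bool) := fun i => T.filter (fun x => ∀ l : Fin m, (l : ℕ) < i → x l = false) with hP
  have hmemP : ∀ i x, x ∈ P i ↔ x ∈ T ∧ ∀ l : Fin m, (l : ℕ) < i → x l = false := fun i x => by
    simp only [hP, mem_filter]
  have hPm : P m = {zeroVec} := by
    ext x
    rw [hmemP, mem_singleton]
    constructor
    · rintro ⟨-, hx⟩
      funext l; exact hx l l.isLt
    · rintro rfl; exact ⟨hT0, fun l _ => rfl⟩
  have hP0 : P 0 = T := by
    ext x
    rw [hmemP]
    exact ⟨fun h => h.1, fun h => ⟨h, fun l hl => absurd hl (Nat.not_lt_zero _)⟩⟩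
  -- each step keeps or halves
  have hstep : ∀ i, i < m → #(P i) = #(P (i + 1)) ∨ #(P i) = 2 * #(P (i + 1)) := by
    intro i hi
    set Q := (P i).filter (fun x => x ⟨i, hi⟩ = true) with hQ
    have hsplit : #(P i) = #(P (i + 1)) + #Q := by
      have e1 : P (i + 1) = (P i).filter (fun x => ¬ x ⟨i, hi⟩ = true) := by
        ext x
        constructor
        · intro hx
          obtain ⟨hxT, hxz⟩ := (hmemP _ x).1 hx
          refine mem_filter.2 ⟨(hmemP i x).2 ⟨hxT, fun l hl => hxz l (by omega)⟩, ?_⟩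
          rw [hxz ⟨i, hi⟩ (by simp)]; exact Bool.false_ne_true
        · intro hx
          obtain ⟨hxP, hxi⟩ := mem_filter.1 hx
          obtain ⟨hxT, hxz⟩ := (hmemP i x).1 hxP
          refine (hmemP _ x).2 ⟨hxT, fun l hl => ?_⟩
          rcases Nat.lt_or_ge (l : ℕ) i with h | h
          · exact hxz l h
          · have hl' : l = ⟨i, hi⟩ := Fin.ext (by simp only; omega)
            rw [hl']; exact eq_false_of_ne_true hxi
      rw [e1, hQ, add_comm]
      exact (card_filter_add_card_filter_not (s := P i) (fun x => x ⟨i, hi⟩ = true)).symm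
    by_cases hQe : Q = ∅
    · left; rw [hsplit, hQe, card_empty, add_zero]
    · right
      obtain ⟨x₀, hx₀⟩ := nonempty_iff_ne_empty.2 hQe
      have hx₀P : x₀ ∈ P i := (mem_filter.1 hx₀).1
      have hx₀i : x₀ ⟨i, hi⟩ = true := (mem_filter.1 hx₀).2
      obtain ⟨hx₀T, hx₀z⟩ := (hmemP i x₀).1 hx₀P
      have hcard : #(P (i + 1)) = #Q := by
        refine card_nbij' (fun y => bxor y x₀) (fun y => bxor y x₀) (fun y hy => ?_) (fun y hy => ?_)
          (fun y _ => by show bxor (bxor y x₀) x₀ = y; rw [iw_bxor_assoc, bxor_self, bxor_zeroVec])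
          (fun y _ => by show bxor (bxor y x₀) x₀ = y; rw [iw_bxor_assoc, bxor_self, bxor_zeroVec])
        · rw [mem_coe, hmemP] at hy
          obtain ⟨hyT, hyz⟩ := hy
          rw [mem_coe, hQ, mem_filter, hmemP]
          refine ⟨⟨hadd y hyT x₀ hx₀T, fun l hl => ?_⟩, ?_⟩
          · show (y l ^^ x₀ l) = false
            rw [hyz l (by omega), hx₀z l hl]; rfl
          · show (y ⟨i, hi⟩ ^^ x₀ ⟨i, hi⟩) = true
            rw [hyz ⟨i, hi⟩ (by simp), hx₀i]; rfl
        · rw [mem_coe, hQ, mem_filter, hmemP] at hy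
          obtain ⟨⟨hyT, hyz⟩, hyi⟩ := hy
          rw [mem_coe, hmemP]
          refine ⟨hadd y hyT x₀ hx₀T, fun l hl => ?_⟩
          show (y l ^^ x₀ l) = false
          rcases Nat.lt_or_ge (l : ℕ) i with h | h
          · rw [hyz l h, hx₀z l h]; rfl
          · have hl' : l = ⟨i, hi⟩ := Fin.ext (by simp only; omega)
            rw [hl', hyi, hx₀i]; rfl
      omega
  -- induction from the top
  have key : ∀ d, d ≤ m → ∃ j, #(P (m - d)) = 2 ^ j := by
    intro d
    induction d with
    | zero => intro _; exact ⟨0, by rw [Nat.sub_zero, hPm, card_singleton, pow_zero]⟩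
    | succ d ih =>
      intro hd
      obtain ⟨j, hj⟩ := ih (by omega)
      have hi : m - (d + 1) < m := by omega
      have e : m - (d + 1) + 1 = m - d := by omega
      rcases hstep (m - (d + 1)) hi with h | h
      · exact ⟨j, by rw [h, e, hj]⟩
      · exact ⟨j + 1, by rw [h, e, hj, pow_succ]; ring⟩
  obtain ⟨j, hj⟩ := key m le_rfl
  rw [Nat.sub_self, hP0] at hj
  exact ⟨j, hj⟩

/-! ### Character sums of a minimum-weight word of `RM(d+1, m)` -/

/-- **Character sums of a flat.**  If `e : 𝔽₂^m → 𝔽₂` has degree `≤ d + 1` and exactly `2^{m−d−1}` ones (a minimum-weight word of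
`RM(d+1,m)`, hence the indicator of a flat `x₀ ⊕ V₀`, `mw_flat_of_minweight`), then for every `z` the character sum
`Σ_{e(x)=1} (−1)^{x·z}` is `0`, `#U` or `−#U` (`U = {e = 1}`). [folklore; cite: MacWilliamsSloane1977 Ch. 13 §4, ODonnell2014 §3.3] -/
theorem ktg2_minweight_twist_sum {m d : ℕ} (e : (Fin m → Bool) → Bool) (he : IsDegLeFun (d + 1) e)
    (hS : 2 ^ (d + 1) * #(univ.filter fun x => e x = true) = 2 ^ m) (z : Fin m → Bool) :
    ∑ x ∈ univ.filter (fun x => e x = true), twist x z = 0 ∨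
      ∑ x ∈ univ.filter (fun x => e x = true), twist x z = #(univ.filter fun x => e x = true) ∨
      ∑ x ∈ univ.filter (fun x => e x = true), twist x z = - #(univ.filter fun x => e x = true) := by
  classical
  obtain ⟨-, hadd, hcardV, hcoset⟩ := mw_flat_of_minweight d e he hS
  set V₀ := univ.filter (fun a : Fin m → Bool => ∀ x, e (bxor x a) = e x) with hV₀
  set U := univ.filter (fun x => e x = true) with hUdef
  have hUpos : 0 < #U := by
    by_contra h0
    push Not at h0
    have : #U = 0 := by omega
    rw [this, mul_zero] at hS
    exact absurd hS.symm (pow_ne_zero _ two_ne_zero)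
  obtain ⟨x₀, hx₀⟩ := card_pos.1 hUpos
  have hU : U = V₀.image (bxor x₀) := hcoset x₀ (mem_filter.1 hx₀).2
  have hsum : ∑ x ∈ U, twist x z = twist x₀ z * ∑ v ∈ V₀, twist v z := by
    rw [hU, sum_image (fun a _ b _ h => by
      have := congrArg (bxor x₀) h; rwa [bxor_bxor_cancel_left, bxor_bxor_cancel_left] at this)]
    rw [mul_sum]
    exact sum_congr rfl fun v _ => twist_bxor_left x₀ v z
  rw [sum_twist_subspace hadd, hcardV] at hsum
  split_ifs at hsum with hall
  · rcases twist_eq_one_or x₀ z with h1 | h1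
    · right; left; rw [hsum, h1, one_mul]
    · right; right; rw [hsum, h1]; ring
  · left; rw [hsum, mul_zero]

end Summit.QuantumAdvantage.QuantumAdvantage.Theorems.CubicForrelation.NearExactIsExact

end
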